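import Mathlib
import Literature.Computability.AlgebraicComplexity.OrbitClosureWeights
import Literature.NumberTheory.DiophantineGeometry.GLHighestWeight
import Summits.ValiantsHypothesis.ValiantsHypothesis.Theorems.ValuativeGCTValuativeFlipCatalecticant
import Summits.ValiantsHypothesis.ValiantsHypothesis.Theorems.ValuativeGCTValuativeFlipEvalRankLowerBoundK3

/-!
# Corner minors of the generic catalecticant: explicit highest-weight vectors of growing length

Crux `ValuativeGCT.ValuativeFlip` (stmt-ValiantsHypothesis-12624), wall-breaker axis
"explicit padded-permanent highest-weight vectors for seedRichness" (k5 gen 1, seat 2), part 3 of 3.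

The P-explicit axis of the crux (`Cruxes/ValuativeFlip/DECOMPOSITIONS.md` §1) needs, for the tail
of the window, EXPLICIT highest-weight vectors of the coordinate ring `k[Sym^m k^σ]`
(`coordRep σ k m`, dual convention `(g·F)(h) = F(g⁻¹·h)`) on shapes of GROWING LENGTH together
with an EVALUATION CALCULUS at points `A · f` of an orbit closure (the certificate format of the
landed per-side engine `stub_evalRankLowerBound`).  The explicit vectors available so far in the
tree have bounded length (coordinate `X_{top}^m`, two-row/binary seeds, Hessian seminvariants,
inner lifts).  This file supplies a classical family of unbounded length with a one-determinant
evaluation rule: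

* `catEntry a b ρ γ = (∏_i (ρ+γ)_i!/γ_i!) · X_{ρ+γ}` — the coordinate function
  `h ↦ coeff_γ (∂^ρ ⌟ h)` (`aeval_formCoeff_catEntry`);
* `catMinor a b i₁ i₂ e = det (catEntry on UpIdx a i₁ × UpIdx b i₂)` — the corner minor of the
  generic catalecticant on the degree-`a` operators in the variables `≥ i₁` and the degree-`b`
  monomials in the variables `≥ i₂`; `aeval_formCoeff_catMinor`: its value at a form `h` is
  `det (catMinorMat a b i₁ i₂ e h)`, one determinant of coefficients of derivatives of `h`;
* **`catMinor_mem_highestWeightSpace`**: it is a highest-weight vector of `coordRep σ k (a+b)` of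
  weight `catWeight a b i₁ i₂ = -(R + C)` (`R_l`, `C_l` = total exponent of the variable `l` over
  the row / column monomials) — for `σ = MatIdx m` a dual partition weight carried by ALL variables
  `≥ min i₁ i₂`, i.e. of length up to `m²`;
* `one_le_orbitMultiplicity_of_catMinor_ne_zero`: by the landed engine, ONE matrix `A` with
  `det Cat(A·f)_corner ≠ 0` certifies that the weight occurs in `ℂ[Δ_{a+b}(f)]`
  (`1 ≤ orbitMultiplicity`); products of corner minors of equal total weight give larger
  certificates through the same engine.
Honest scope: these are occurrence-grade (`D = 1`) certificates on both sides (flattenings of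
`det_m` dominate those of `X^{m-n} per_n`), not flips; they are the missing "evaluation calculus on
growing length" building block, not a tail mechanism.
[Fulton–Harris §15.5; Landsberg 2017 §7.2, §8.2; BLMW 2011 (5.2.2); Iarrobino–Kanev §1.1; folklore]
-/

set_option linter.dupNamespace false

namespace Summit.ValiantsHypothesis.ValiantsHypothesis.Theorems.ValuativeFlip

open MvPolynomial
open scoped BigOperators Matrix
open Literature.Computability.AlgebraicComplexity
open Literature.NumberTheory.DiophantineGeometry

noncomputable section

section HWV

variable {σ : Type*} [Fintype σ] [LinearOrder σ] {k : Type*} [Field k]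

omit [Fintype σ] in
/-- **Coefficients of a monomial derivative**: the coefficient of `X^γ` in `∂^ρ h` is
`(∏_i (ρ+γ)_i! / γ_i!) · coeff_{ρ+γ} h`. Iarrobino–Kanev §1.1. [folklore] -/
theorem coeff_apolarAction_monomial_one (ρ γ : σ →₀ ℕ) (h : MvPolynomial σ k) :
    coeff γ (apolarAction (monomial ρ (1 : k)) h) =
      coeff (ρ + γ) h * ∏ i ∈ ρ.support, (Nat.descFactorial ((ρ + γ) i) (ρ i) : k) := by
  classical
  induction h using MvPolynomial.induction_on' with
  | monomial d c =>
    by_cases hle : ρ ≤ d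
    · rw [apolarAction_monomial_monomial, coeff_monomial, coeff_monomial, one_mul]
      by_cases hd : d = ρ + γ
      · subst hd
        rw [if_pos (add_tsub_cancel_left ρ γ), if_pos rfl]
      · have hne : d - ρ ≠ γ := fun h' => hd (by rw [← h', add_tsub_cancel_of_le hle])
        rw [if_neg hne, if_neg hd, zero_mul]
    · rw [apolarAction_monomial_monomial_of_not_le hle, coeff_zero, coeff_monomial]
      have hd : ¬ d = ρ + γ := fun h' => hle (h' ▸ le_self_add)
      rw [if_neg hd, zero_mul]
  | add p q hp hq =>
    rw [apolarAction_add_right, coeff_add, coeff_add, hp, hq, add_mul]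

/-- The degree-`(a+b)` index `ρ + γ`. [folklore] -/
def addIdx {a b : ℕ} (ρ : DegIdx σ a) (γ : DegIdx σ b) : DegIdx σ (a + b) :=
  ⟨ρ.1 + γ.1, by
    rw [mem_degMonomials_iff, map_add, mem_degMonomials_iff.mp ρ.2, mem_degMonomials_iff.mp γ.2]⟩

/-- **The catalecticant entry as a coordinate function**: the linear form on coefficient space
`h ↦ coeff_{X^γ} (∂^ρ h) = (∏_i (ρ+γ)_i!/γ_i!) · X_{ρ+γ}`. [folklore] -/
def catEntry (a b : ℕ) (ρ : DegIdx σ a) (γ : DegIdx σ b) : MvPolynomial (DegIdx σ (a + b)) k :=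
  C (∏ i ∈ ρ.1.support, (Nat.descFactorial ((ρ.1 + γ.1) i) (ρ.1 i) : k)) * X (addIdx ρ γ)

/-- Evaluation of the entry functional at a form: the catalecticant entry. [folklore] -/
theorem aeval_formCoeff_catEntry (a b : ℕ) (ρ : DegIdx σ a) (γ : DegIdx σ b) (h : MvPolynomial σ k) :
    aeval (formCoeff (a + b) h) (catEntry (k := k) a b ρ γ) = catMat a b h ρ γ := by
  rw [catEntry, map_mul, aeval_C, aeval_X, formCoeff_apply, catMat_apply,
    coeff_apolarAction_monomial_one, Algebra.algebraMap_self, RingHom.id_apply, mul_comm]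
  rfl

/-- **The corner minor** `F_{a,b;i₁,i₂}`: the determinant of the block of the generic catalecticant
`Cat_{a,b}` on the degree-`a` monomial operators in the variables `≥ i₁` (rows) and the degree-`b`
monomials in the variables `≥ i₂` (columns), a polynomial function of degree `#rows` on the
coefficient space `Sym^{a+b}`.  For `σ = MatIdx m`, `a + b = m` these are explicit elements of
`ℂ[Sym^m ℂ^{m×m}]` of GROWING LENGTH (every variable `≥ min i₁ i₂` carries weight).
Landsberg 2017 §7.2, §8.2 (flattenings / minors of catalecticants as modules of equations). [folklore] -/
def catMinor (a b : ℕ) (i₁ i₂ : σ) (e : UpIdx σ a i₁ ≃ UpIdx σ b i₂) : MvPolynomial (DegIdx σ (a + b)) k :=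
  (Matrix.of fun r r' : UpIdx σ a i₁ => catEntry (k := k) a b r.idx (e r').idx).det

/-- **Evaluation of the corner minor at a form** `h`: the determinant of the corner block of the
catalecticant of `h` — the certificate format of the per-side engine (`stub_evalRankLowerBound`):
nonvanishing at a point `A · f` of the orbit closure is decided by one determinant of coefficients
of derivatives of the restriction `A · f`. [folklore] -/
theorem aeval_formCoeff_catMinor (a b : ℕ) (i₁ i₂ : σ) (e : UpIdx σ a i₁ ≃ UpIdx σ b i₂)
    (h : MvPolynomial σ k) :
    aeval (formCoeff (a + b) h) (catMinor (k := k) a b i₁ i₂ e) = (catMinorMat a b i₁ i₂ e h).det := by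
  rw [catMinor, AlgHom.map_det]
  congr 1
  ext r r'
  rw [AlgHom.mapMatrix_apply, Matrix.map_apply, Matrix.of_apply, catMinorMat_apply]
  exact aeval_formCoeff_catEntry a b r.idx (e r').idx h

/-- **The weight of the corner minor**: minus the total exponent of each variable over all row and
column monomials (dual, i.e. coordinate-ring, convention of `coordRep`): for `σ = MatIdx m` a dual
partition weight `λ*` whose length is the number of variables `≥ min i₁ i₂`. [folklore] -/
def catWeight (a b : ℕ) (i₁ i₂ : σ) : Weight σ :=
  fun l => -((expSum (σ := σ) a i₁ l + expSum (σ := σ) b i₂ l : ℕ) : ℤ)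

/-- The form with a prescribed degree-`m` coefficient vector. [folklore] -/
theorem cmh_formCoeff_sum_smul_monomial (m : ℕ) (x : DegIdx σ m → k) :
    formCoeff m (∑ d : DegIdx σ m, x d • monomial d.1 (1 : k)) = x := by
  classical
  funext d
  rw [formCoeff_apply, coeff_sum]
  simp only [coeff_smul, coeff_monomial, smul_eq_mul, mul_ite, mul_one, mul_zero]
  rw [Finset.sum_eq_single d]
  · simp
  · intro d' _ hne
    rw [if_neg (fun h => hne (Subtype.ext h))]
  · intro h; exact absurd (Finset.mem_univ d) h

/-- **The corner minors are highest-weight vectors.**  For every upper triangular `g ∈ GL(k^σ)`,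
`g · F = (∏_l g_{ll}^{-(R_l + C_l)}) F` for the corner minor `F = F_{a,b;i₁,i₂}` of the generic
catalecticant, `R_l`, `C_l` the exponent sums of the row/column monomials at `l`: an EXPLICIT
highest-weight vector of `k[Sym^{a+b} k^σ]` (`coordRep`) of weight `catWeight a b i₁ i₂`, whose
length (number of variables carrying weight) grows with the corner.  Mechanism: `Cat(g⁻¹·h)` has
corner block `S_RRᵀ · Cat(h)_corner · T_CCᵀ` with `S_RR`, `T_CC` triangular for the lexicographic
order of monomials (`det_catMinorMat_linSubst`), and `(g⁻¹)_{ll} = g_{ll}⁻¹`.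
Fulton–Harris §15.5; Landsberg 2017 §7.2, §8.2; BLMW 2011 (5.2.2) (dual weights of coordinate
rings). [folklore] -/
theorem catMinor_mem_highestWeightSpace [CharZero k] (a b : ℕ) (i₁ i₂ : σ)
    (e : UpIdx σ a i₁ ≃ UpIdx σ b i₂) :
    catMinor a b i₁ i₂ e ∈ highestWeightSpace (coordRep σ k (a + b)) (catWeight (σ := σ) a b i₁ i₂) := by
  classical
  rw [mem_highestWeightSpace_iff]
  intro g hg
  rw [coordRep_apply]
  have hB : ((g⁻¹ : GL σ k) : Matrix σ σ k).BlockTriangular id := (borelSubgroup σ k).inv_mem hg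
  have hdiag : ∀ l, ((g⁻¹ : GL σ k) : Matrix σ σ k) l l = ((g : Matrix σ σ k) l l)⁻¹ :=
    fun l => inv_apply_diag_of_isUpperTriangular' hg l
  have hchar : (∏ l, ((g⁻¹ : GL σ k) : Matrix σ σ k) l l ^ (expSum (σ := σ) a i₁ l + expSum (σ := σ) b i₂ l)) =
      weightChar (catWeight (σ := σ) a b i₁ i₂) g := by
    rw [weightChar]
    refine Finset.prod_congr rfl fun l _ => ?_
    rw [hdiag, catWeight, zpow_neg, zpow_natCast, inv_pow]
  apply MvPolynomial.funext
  intro x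
  change aeval x (coordSubst (a + b) g (catMinor a b i₁ i₂ e)) =
    aeval x (weightChar (catWeight (σ := σ) a b i₁ i₂) g • catMinor a b i₁ i₂ e)
  set hx : MvPolynomial σ k := ∑ d : DegIdx σ (a + b), x d • monomial d.1 (1 : k) with hhx
  have hfc : formCoeff (a + b) hx = x := cmh_formCoeff_sum_smul_monomial (a + b) x
  rw [← hfc, aeval_formCoeff_coordSubst, linSubstRep_apply,
    aeval_formCoeff_catMinor, det_catMinorMat_linSubst hB, hchar, map_smul, smul_eq_mul,
    aeval_formCoeff_catMinor]

end HWV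

/-! ### Occurrence certificates through the per-side engine -/

section Occurrence

/-- **One nonzero corner minor certifies occurrence.**  If for some matrix `A` (singular allowed)
the corner block of the catalecticant of `A · f` is nonsingular, then the weight
`catWeight a b i₁ i₂` occurs in the coordinate ring of the orbit closure `Δ_{a+b}(f)`:
`1 ≤ orbitMultiplicity ℂ f (a+b) (catWeight a b i₁ i₂)`.  The landed per-side engine
`stub_evalRankLowerBound` with `D = 1`, `F = catMinor`. [this crux (PE1); folklore] -/
theorem one_le_orbitMultiplicity_of_catMinor_ne_zero {σ : Type} [Fintype σ] [LinearOrder σ]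
    (f : MvPolynomial σ ℂ) (a b : ℕ) (hm : a + b ≠ 0) (i₁ i₂ : σ)
    (e : UpIdx σ a i₁ ≃ UpIdx σ b i₂) (A : Matrix σ σ ℂ)
    (hA : (catMinorMat a b i₁ i₂ e (linSubst σ ℂ A f)).det ≠ 0) :
    1 ≤ orbitMultiplicity ℂ f (a + b) (catWeight (σ := σ) a b i₁ i₂) := by
  refine stub_evalRankLowerBound f (a + b) hm (catWeight (σ := σ) a b i₁ i₂) 1
    (fun _ => catMinor a b i₁ i₂ e) (fun _ => catMinor_mem_highestWeightSpace a b i₁ i₂ e)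
    (fun _ => A) ?_
  rw [Matrix.det_fin_one, Matrix.of_apply, aeval_formCoeff_catMinor]
  exact hA

end Occurrence

end

end Summit.ValiantsHypothesis.ValiantsHypothesis.Theorems.ValuativeFlip
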